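import Summits.CriticalPhenomena.SAWScalingLimit.Theorems.SAWDevelopingMapHexTransferPortDictionaryWeights
import Literature.Probability.RandomPlanarGeometry.YangBaxterSAWComplex
import Mathlib.Combinatorics.SimpleGraph.Basic
import Mathlib.Data.List.TakeWhile
import HarnessLib

/-!
# Port dictionary, part 3: compass paths as vertex lists, cut at their ports

Support file for item stmt-CriticalPhenomena-6966 (`SAWCompassLattice.PortDictionary`), stub
`stub_portDictionary` of line `Sketch` of crux stmt-CriticalPhenomena-14221 (`HexTransfer`);
continues parts 1–2 (`…PortDictionaryGadget`, `…PortDictionaryWeights`).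

* `Compass`: the hypothesis structure — a graph `G` on `V = MidEdge ⊕ Face × Node` and dart
  weights `y` with exactly the adjacency / weight tables of the item's compass lattice (ports are
  pairwise non-adjacent; port `e` ~ terminal `(f, (0, i))` iff `f.side (cyc i) = e`; gadget vertices
  are adjacent iff same face and `adjB`; weights `z` on port–terminal darts and `edgeW` inside).
* `compassLists C Δ U a b ms`: the vertex lists of the simple paths of `G` from port `a` to port `b`
  through gadgets of faces of `Δ` only, with port sequence `ms`, avoiding the used vertices `U f`
  of each face `f` (the item has `U = ∅`; the generalisation drives the induction of part 4).
* `mem_compassLists_cons_cons` / `cons_mem_compassLists`: such a list with port sequence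
  `e₀ :: e₁ :: rest` is EXACTLY `inl e₀ :: (route inside the gadget of the common face `f` of
  `e₀, e₁`, from the terminal of `e₀` to that of `e₁`, avoiding `U f`) ++ (a list of the same kind
  from `e₁` with port sequence `e₁ :: rest` avoiding moreover that route)`; degree-2 ports force
  `f ∈ Δ`, `e₀ ∉ e₁ :: rest`.  `wtL` (product of dart weights) factors accordingly (`wtL_glue`).
-/

namespace Summit.CriticalPhenomena.SAWScalingLimit.Cruxes.HexTransfer.Sketch.PortDict

open Literature.Probability.RandomPlanarGeometry.SAW.YangBaxter

/-! ## Sides of a face indexed by `Fin 4` -/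

/-- `cyc` takes each side exactly once. -/
theorem cyc_inj {k k' : Fin 4} : cyc k = cyc k' ↔ k = k' := by
  revert k k'; decide

/-- The index of the side of `f` carrying the mid-edge `e` (junk `3` if `e` is not a side of `f`). -/
def sideIdx (f : Face) (e : MidEdge) : Fin 4 :=
  if f.side Side.W = e then 0 else if f.side Side.N = e then 1 else if f.side Side.E = e then 2 else 3

/-- `sideIdx` inverts `k ↦ f.side (cyc k)`. -/
theorem sideIdx_side_cyc (f : Face) (k : Fin 4) : sideIdx f (f.side (cyc k)) = k := by
  have hinj := Face.side_injective f
  fin_cases k <;> simp [sideIdx, cyc, hinj.eq_iff]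

/-- If `f.side (cyc k) = e` then `sideIdx f e = k`. -/
theorem sideIdx_of_side_cyc {f : Face} {k : Fin 4} {e : MidEdge} (h : f.side (cyc k) = e) : sideIdx f e = k := by
  subst h; exact sideIdx_side_cyc f k

/-- Every side is some `cyc k`. -/
theorem exists_cyc_eq (sd : Side) : ∃ k : Fin 4, cyc k = sd := by
  cases sd
  · exact ⟨0, rfl⟩
  · exact ⟨2, rfl⟩
  · exact ⟨3, rfl⟩
  · exact ⟨1, rfl⟩

/-- A side of `f` is recovered from its index. -/
theorem side_cyc_sideIdx {f : Face} {e : MidEdge} (h : ∃ sd, f.side sd = e) : f.side (cyc (sideIdx f e)) = e := by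
  obtain ⟨sd, rfl⟩ := h
  obtain ⟨k, rfl⟩ := exists_cyc_eq sd
  rw [sideIdx_side_cyc]

/-! ## The compass lattice: hypothesis structure -/

/-- The vertex type of the compass lattice: ports (mid-edges) and gadget vertices (face, node). -/
abbrev V : Type := MidEdge ⊕ Face × Node

/-- The gadget vertex `q` of the face `f`. -/
def ι (f : Face) (q : Node) : V := Sum.inr (f, q)

/-- `ι f` is injective. -/
theorem ι_injective (f : Face) : Function.Injective (ι f) := fun q q' h => by
  simpa [ι] using h

/-- **The compass lattice (hypothesis structure).** A graph on `V` and dart weights with the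
adjacency and weight tables of the item's `G = fromRel R` and `y`: ports are never adjacent to
ports; the port `e` is adjacent to the gadget vertex `(f, q)` iff `q` is the terminal `(0, i)` with
`f.side (cyc i) = e`; gadget vertices are adjacent iff they lie in the same face and are
`adjB`-adjacent; port–terminal darts weigh `z`, internal darts `edgeW α β s`; fugacities `≥ 0`. -/
structure Compass where
  /-- the compass graph -/
  G : SimpleGraph V
  /-- the dart weights -/
  y : V → V → ℝ
  /-- outer-cycle fugacity -/
  α : ℝ
  /-- inner-cycle fugacity -/
  β : ℝ
  /-- spoke fugacity -/
  s : ℝ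
  /-- port–terminal fugacity -/
  z : ℝ
  hα : 0 ≤ α
  hβ : 0 ≤ β
  hs : 0 ≤ s
  adj_inl_inl : ∀ e e' : MidEdge, ¬G.Adj (Sum.inl e) (Sum.inl e')
  adj_inl_inr : ∀ (e : MidEdge) (f : Face) (q : Node),
    G.Adj (Sum.inl e) (Sum.inr (f, q)) ↔ q.1 = 0 ∧ f.side (cyc q.2) = e
  adj_inr_inr : ∀ (f : Face) (q : Node) (f' : Face) (q' : Node),
    G.Adj (Sum.inr (f, q)) (Sum.inr (f', q')) ↔ f = f' ∧ adjB q q' = true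
  y_inl_inr : ∀ (e : MidEdge) (x : Face × Node), y (Sum.inl e) (Sum.inr x) = z
  y_inr_inl : ∀ (x : Face × Node) (e : MidEdge), y (Sum.inr x) (Sum.inl e) = z
  y_inr_inr : ∀ (f : Face) (q : Node) (f' : Face) (q' : Node), y (Sum.inr (f, q)) (Sum.inr (f', q')) = edgeW α β s q q'

/-- Extending the used vertices of the face `f` by the route `r`. -/
def upd (U : Face → List Node) (f : Face) (r : List Node) : Face → List Node :=
  Function.update U f (U f ++ r)

/-- `upd` on the face itself and elsewhere. -/
theorem upd_apply (U : Face → List Node) (f : Face) (r : List Node) (f' : Face) :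
    upd U f r f' = if f' = f then U f ++ r else U f' := by
  unfold upd; rw [Function.update_apply]

namespace Compass

variable (C : Compass)

/-- Port–gadget adjacency, gadget side first. -/
theorem adj_inr_inl (f : Face) (q : Node) (e : MidEdge) :
    C.G.Adj (Sum.inr (f, q)) (Sum.inl e) ↔ q.1 = 0 ∧ f.side (cyc q.2) = e := by
  rw [C.G.adj_comm, C.adj_inl_inr]

/-- **The weight of a vertex list**: the product of the dart weights of consecutive vertices
(the item's `wt` read on the support of a walk). -/
def wtL : List V → ℝ
  | [] => 1
  | [_] => 1
  | x :: x' :: t => C.y x x' * wtL (x' :: t)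

/-- `wtL` of a two-step list. -/
@[simp] theorem wtL_cons_cons (x x' : V) (t : List V) : C.wtL (x :: x' :: t) = C.y x x' * C.wtL (x' :: t) := rfl

/-- `wtL` of a singleton. -/
@[simp] theorem wtL_singleton (x : V) : C.wtL [x] = 1 := rfl

/-- `wtL` splits at any vertex. -/
theorem wtL_append_cons : ∀ (l₁ : List V) (x : V) (l₂ : List V),
    C.wtL (l₁ ++ x :: l₂) = C.wtL (l₁ ++ [x]) * C.wtL (x :: l₂)
  | [], x, l₂ => by simp
  | [a], x, l₂ => by simp
  | a :: b :: l₁, x, l₂ => by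
    have ih := wtL_append_cons (b :: l₁) x l₂
    simp only [List.cons_append, wtL_cons_cons] at ih ⊢
    rw [ih, mul_assoc]

/-- The weight of a route of the gadget of `f` followed by the port dart: `routeW · z`. -/
theorem wtL_map_ι_append_inl (f : Face) (e : MidEdge) : ∀ (r : List Node), r ≠ [] →
    C.wtL (r.map (ι f) ++ [Sum.inl e]) = routeW C.α C.β C.s r * C.z
  | [], h => (h rfl).elim
  | [q], _ => by simp [ι, routeW, C.y_inr_inl]
  | q :: q' :: r, _ => by
    simp only [List.map_cons, List.cons_append, wtL_cons_cons]
    have := wtL_map_ι_append_inl f e (q' :: r) (List.cons_ne_nil _ _)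
    simp only [List.map_cons, List.cons_append] at this
    rw [this, routeW, ι, ι, C.y_inr_inr, mul_assoc]

/-- **Weight of a glued list**: port dart, route, port dart, rest. -/
theorem wtL_glue (e₀ : MidEdge) (f : Face) {r : List Node} (hr : r ≠ []) {l₂ : List V} {e₁ : MidEdge}
    (hl₂ : l₂.head? = some (Sum.inl e₁)) :
    C.wtL (Sum.inl e₀ :: (r.map (ι f) ++ l₂)) = C.z ^ 2 * routeW C.α C.β C.s r * C.wtL l₂ := by
  obtain ⟨l₂, rfl⟩ := List.head?_eq_some_iff.1 hl₂
  obtain ⟨q, r', rfl⟩ := List.exists_cons_of_ne_nil hr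
  simp only [List.map_cons, List.cons_append, wtL_cons_cons]
  have h1 := C.wtL_append_cons (ι f q :: (r'.map (ι f))) (Sum.inl e₁) l₂
  simp only [List.cons_append] at h1
  have h2 := C.wtL_map_ι_append_inl f e₁ (q :: r') (List.cons_ne_nil _ _)
  simp only [List.map_cons, List.cons_append] at h2
  rw [h1, h2, ι, C.y_inl_inr]
  ring

/-! ## Compass lists -/

/-- **Compass lists.** The vertex lists of the simple paths of `C.G` from the port `a` to the port
`b` using gadget vertices of faces of `Δ` only, with ordered port sequence `ms`, and using in
the gadget of each face `f` no vertex of `U f`. -/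
def compassLists (Δ : Set Face) (U : Face → List Node) (a b : MidEdge) (ms : List MidEdge) : Set (List V) :=
  {l | l.head? = some (Sum.inl a) ∧ l.getLast? = some (Sum.inl b) ∧ l.IsChain C.G.Adj ∧ l.Nodup ∧
    (∀ (f : Face) (q : Node), Sum.inr (f, q) ∈ l → f ∈ Δ) ∧ l.filterMap Sum.getLeft? = ms ∧
    ∀ (f : Face) (q : Node), Sum.inr (f, q) ∈ l → q ∉ U f}

variable {C} {Δ : Set Face} {U : Face → List Node} {a b : MidEdge} {ms : List MidEdge}

/-- Unfolding membership in `compassLists`. -/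
theorem mem_compassLists {l : List V} : l ∈ C.compassLists Δ U a b ms ↔
    l.head? = some (Sum.inl a) ∧ l.getLast? = some (Sum.inl b) ∧ l.IsChain C.G.Adj ∧ l.Nodup ∧
    (∀ (f : Face) (q : Node), Sum.inr (f, q) ∈ l → f ∈ Δ) ∧ l.filterMap Sum.getLeft? = ms ∧
    ∀ (f : Face) (q : Node), Sum.inr (f, q) ∈ l → q ∉ U f := Iff.rfl

/-- In a chain of gadget vertices, the face is constant. -/
theorem exists_eq_map_ι (f : Face) : ∀ (q : Node) (w : List V),
    (Sum.inr (f, q) :: w).IsChain C.G.Adj → (∀ v ∈ w, v.isRight) → ∃ r : List Node, w = r.map (ι f)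
  | q, [], _, _ => ⟨[], rfl⟩
  | q, v :: w, hc, hw => by
    obtain ⟨⟨f', q'⟩, rfl⟩ := Sum.isRight_iff.1 (hw v (by simp))
    rw [List.isChain_cons_cons] at hc
    obtain ⟨rfl, -⟩ := (C.adj_inr_inr f q f' q').1 hc.1
    obtain ⟨r, rfl⟩ := exists_eq_map_ι f q' w hc.2 fun v hv => hw v (by simp [hv])
    exact ⟨q' :: r, rfl⟩

/-- **Decomposition at the first port.** A compass list with port sequence `e₀ :: e₁ :: rest` is
`inl e₀ ::` a route of the gadget of the common face `f ∈ Δ` of `e₀ ≠ e₁` (from the terminal of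
`e₀` to that of `e₁`, avoiding `U f`) `++` a compass list from `e₁` with ports `e₁ :: rest`
avoiding moreover that route; and `e₀ ∉ e₁ :: rest`. -/
theorem mem_compassLists_cons_cons {l : List V} {e₀ e₁ : MidEdge} {rest : List MidEdge}
    (h : l ∈ C.compassLists Δ U e₀ b (e₀ :: e₁ :: rest)) :
    ∃ (f : Face) (r : List Node) (l₂ : List V), MidEdge.commonFace e₀ e₁ = some f ∧ f ∈ Δ ∧
      e₀ ∉ e₁ :: rest ∧ r ∈ routes (sideIdx f e₀) (sideIdx f e₁) ∧ (∀ x ∈ r, x ∉ U f) ∧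
      l₂ ∈ C.compassLists Δ (upd U f r) e₁ b (e₁ :: rest) ∧ l = Sum.inl e₀ :: (r.map (ι f) ++ l₂) := by
  obtain ⟨h1, h2, h3, h4, h5, h6, h7⟩ := h
  obtain ⟨t, rfl⟩ := List.head?_eq_some_iff.1 h1
  -- cut `t` at its first port
  obtain ⟨seg, l₂, ht, hsegR, hl₂head⟩ : ∃ seg l₂ : List V, t = seg ++ l₂ ∧ (∀ v ∈ seg, v.isRight = true) ∧
      ∀ (x : V) (l' : List V), l₂ = x :: l' → ¬(x.isRight = true) := by
    refine ⟨t.takeWhile fun v => v.isRight, t.dropWhile fun v => v.isRight,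
      List.takeWhile_append_dropWhile.symm, fun v hv => List.mem_takeWhile_imp hv, fun x l' hx => ?_⟩
    have hne : (t.dropWhile fun v => v.isRight) ≠ [] := by rw [hx]; exact List.cons_ne_nil _ _
    have := List.head_dropWhile_not (fun v : V => v.isRight) hne
    simp only [hx, List.head_cons] at this
    simp [this]
  -- the ports of `t` are those of `l₂`
  have hports : l₂.filterMap Sum.getLeft? = e₁ :: rest := by
    have : t.filterMap Sum.getLeft? = e₁ :: rest := by simpa using h6
    rw [ht, List.filterMap_append, List.filterMap_eq_nil_iff.2, List.nil_append] at this
    · exact this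
    · intro v hv
      obtain ⟨x, rfl⟩ := Sum.isRight_iff.1 (hsegR v hv)
      rfl
  -- `l₂` starts with the port `e₁`
  obtain ⟨l₂', rfl⟩ : ∃ l₂', l₂ = Sum.inl e₁ :: l₂' := by
    have hne : l₂ ≠ [] := by
      intro h0; rw [h0] at hports; simp at hports
    obtain ⟨x, l₂', rfl⟩ := List.exists_cons_of_ne_nil hne
    obtain ⟨e, rfl⟩ := Sum.isLeft_iff.1 (Sum.not_isRight.1 (hl₂head x l₂' rfl))
    have : e :: l₂'.filterMap Sum.getLeft? = e₁ :: rest := by simpa using hports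
    rw [List.cons.injEq] at this
    exact ⟨l₂', by rw [this.1]⟩
  -- `seg` is non-empty and starts at the terminal of `e₀` in some face `f`
  have hchain : (Sum.inl e₀ :: (seg ++ Sum.inl e₁ :: l₂')).IsChain C.G.Adj := by rwa [← ht]
  obtain ⟨v₁, seg', rfl⟩ : ∃ v₁ seg', seg = v₁ :: seg' := by
    cases seg with
    | nil =>
      exfalso
      rw [List.nil_append, List.isChain_cons_cons] at hchain
      exact C.adj_inl_inl _ _ hchain.1
    | cons v₁ seg' => exact ⟨v₁, seg', rfl⟩
  obtain ⟨⟨f, q₁⟩, rfl⟩ := Sum.isRight_iff.1 (hsegR v₁ (by simp))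
  rw [List.cons_append, List.isChain_cons_cons] at hchain
  obtain ⟨hq₁, hfe₀⟩ := (C.adj_inl_inr e₀ f q₁).1 hchain.1
  -- all of `seg` lies in the gadget of `f`
  obtain ⟨r', rfl⟩ := C.exists_eq_map_ι f q₁ seg' hchain.2.left_of_append fun v hv => hsegR v (by simp [hv])
  have hsegr : Sum.inr (f, q₁) :: r'.map (ι f) = (q₁ :: r').map (ι f) := rfl
  -- the last vertex of `seg` is the terminal of `e₁`
  have hne : q₁ :: r' ≠ [] := List.cons_ne_nil _ _
  obtain ⟨hqm0, hfe₁⟩ : ((q₁ :: r').getLast hne).1 = 0 ∧ f.side (cyc ((q₁ :: r').getLast hne).2) = e₁ := by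
    have hc2 : ((q₁ :: r').map (ι f) ++ Sum.inl e₁ :: l₂').IsChain C.G.Adj := hchain.2
    obtain ⟨-, -, hjoin⟩ := List.isChain_append.1 hc2
    exact (C.adj_inr_inl f _ e₁).1 (hjoin _ (by rw [List.getLast?_map, List.getLast?_eq_some_getLast hne]; rfl) _ rfl)
  -- ports: `e₀ ∉ e₁ :: rest`
  have he₀ : e₀ ∉ e₁ :: rest := by
    intro hmem
    rw [← hports, List.mem_filterMap] at hmem
    obtain ⟨v, hv, hve⟩ := hmem
    rw [Sum.getLeft?_eq_some_iff] at hve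
    subst hve
    have : Sum.inl e₀ ∈ t := by rw [ht]; exact List.mem_append_right _ hv
    exact (List.nodup_cons.1 h4).1 this
  have hne01 : e₀ ≠ e₁ := fun h => he₀ (by simp [h])
  have htail : ((q₁ :: r').map (ι f) ++ Sum.inl e₁ :: l₂').IsChain C.G.Adj ∧
      ((q₁ :: r').map (ι f) ++ Sum.inl e₁ :: l₂').Nodup := by
    constructor
    · have := h3.tail; rwa [List.tail_cons, ht] at this
    · have := (List.nodup_cons.1 h4).2; rwa [ht] at this
  refine ⟨f, q₁ :: r', Sum.inl e₁ :: l₂', ?_, h5 f q₁ (by simp [ht]), he₀, ?_, ?_, ?_, by rw [ht, ← hsegr]⟩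
  · exact (MidEdge.commonFace_eq_some_iff e₀ e₁ f).2 ⟨hne01, ⟨_, hfe₀⟩, ⟨_, hfe₁⟩⟩
  · -- `q₁ :: r'` is a route between the two terminals
    rw [mem_routes_iff]
    refine ⟨?_, ?_, ?_, ?_⟩
    · rw [List.head?_cons, sideIdx_of_side_cyc hfe₀]
      obtain ⟨l₁, i₁⟩ := q₁
      simp only at hq₁; subst hq₁; rfl
    · rw [List.getLast?_eq_some_getLast hne, sideIdx_of_side_cyc hfe₁]
      generalize (q₁ :: r').getLast hne = qm at hqm0 ⊢
      obtain ⟨lm, im⟩ := qm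
      simp only at hqm0; subst hqm0; rfl
    · have := htail.1.left_of_append
      rw [List.isChain_map] at this
      exact this.imp fun a b hab => ((C.adj_inr_inr f a f b).1 hab).2
    · exact (htail.2.sublist (List.sublist_append_left _ _)).of_map _
  · -- the route avoids `U f`
    intro x hx
    refine h7 f x ?_
    rw [ht]
    exact List.mem_cons_of_mem _ (List.mem_append_left _ (hsegr ▸ List.mem_map.2 ⟨x, hx, rfl⟩))
  · -- `l₂` is a compass list from `e₁`, avoiding moreover the route
    refine ⟨rfl, ?_, htail.1.right_of_append, htail.2.sublist (List.sublist_append_right _ _),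
      fun f' q hq => h5 f' q ?_, hports, fun f' q hq => ?_⟩
    · have hl₂ne : (Sum.inl e₁ :: l₂' : List V) ≠ [] := List.cons_ne_nil _ _
      have hw := List.getLast?_eq_some_getLast hl₂ne
      rw [ht, List.getLast?_cons, List.getLast?_append, hw] at h2
      rw [hw]
      simpa using h2
    · rw [ht]; exact List.mem_cons_of_mem _ (List.mem_append_right _ hq)
    · rw [upd_apply]
      split_ifs with hf
      · subst hf
        intro hmem
        rcases List.mem_append.1 hmem with hU | hr_mem
        · exact h7 _ q (by rw [ht]; exact List.mem_cons_of_mem _ (List.mem_append_right _ hq)) hU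
        · have hnd := htail.2
          rw [List.nodup_append] at hnd
          exact hnd.2.2 _ (List.mem_map.2 ⟨q, hr_mem, rfl⟩) _ hq rfl
      · exact h7 f' q (by rw [ht]; exact List.mem_cons_of_mem _ (List.mem_append_right _ hq))

/-- **Gluing at the first port.** Conversely, a route of the gadget of the common face `f ∈ Δ` of
`e₀, e₁`, avoiding `U f`, followed by a compass list from `e₁` with ports `e₁ :: rest ∌ e₀` avoiding
moreover the route, is a compass list from `e₀` with ports `e₀ :: e₁ :: rest`. -/
theorem cons_mem_compassLists {e₀ e₁ : MidEdge} {rest : List MidEdge} {f : Face} {r : List Node}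
    {l₂ : List V} (hf : MidEdge.commonFace e₀ e₁ = some f) (hfΔ : f ∈ Δ) (he₀ : e₀ ∉ e₁ :: rest)
    (hr : r ∈ routes (sideIdx f e₀) (sideIdx f e₁)) (hrU : ∀ x ∈ r, x ∉ U f)
    (hl₂ : l₂ ∈ C.compassLists Δ (upd U f r) e₁ b (e₁ :: rest)) :
    Sum.inl e₀ :: (r.map (ι f) ++ l₂) ∈ C.compassLists Δ U e₀ b (e₀ :: e₁ :: rest) := by
  obtain ⟨g1, g2, g3, g4, g5, g6, g7⟩ := hl₂
  obtain ⟨l₂', rfl⟩ := List.head?_eq_some_iff.1 g1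
  obtain ⟨hne01, hs0, hs1⟩ := (MidEdge.commonFace_eq_some_iff e₀ e₁ f).1 hf
  rw [mem_routes_iff] at hr
  obtain ⟨hrh, hrl, hrc, hrn⟩ := hr
  obtain ⟨r', rfl⟩ := List.head?_eq_some_iff.1 hrh
  have hmem_map : ∀ v : V, v ∈ (((0 : Fin 3), sideIdx f e₀) :: r').map (ι f) →
      ∃ q ∈ ((0 : Fin 3), sideIdx f e₀) :: r', v = Sum.inr (f, q) := fun v hv => by
    obtain ⟨q, hq, rfl⟩ := List.mem_map.1 hv
    exact ⟨q, hq, rfl⟩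
  refine ⟨rfl, ?_, ?_, ?_, ?_, ?_, ?_⟩
  · -- last port
    rw [List.getLast?_cons, List.getLast?_append, g2]
    rfl
  · -- chain
    rw [List.map_cons, List.cons_append, List.isChain_cons_cons]
    refine ⟨(C.adj_inl_inr e₀ f _).2 ⟨rfl, side_cyc_sideIdx hs0⟩, ?_⟩
    rw [← List.cons_append, ← List.map_cons (f := ι f)]
    refine List.IsChain.append ?_ g3 fun x hx y hy => ?_
    · rw [List.isChain_map]
      exact hrc.imp fun a b hab => (C.adj_inr_inr f a f b).2 ⟨rfl, hab⟩
    · rw [List.getLast?_map, hrl] at hx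
      simp only [Option.map_some, Option.mem_def, Option.some.injEq] at hx
      simp only [List.head?_cons, Option.mem_def, Option.some.injEq] at hy
      subst hx; subst hy
      exact (C.adj_inr_inl f _ e₁).2 ⟨rfl, side_cyc_sideIdx hs1⟩
  · -- no repeated vertex
    rw [List.nodup_cons, List.nodup_append]
    refine ⟨?_, hrn.map (ι_injective f), g4, ?_⟩
    · rw [List.mem_append, not_or]
      refine ⟨fun h => ?_, fun h => he₀ ?_⟩
      · obtain ⟨q, -, hq⟩ := hmem_map _ h
        cases hq
      · rw [← g6]
        exact List.mem_filterMap.2 ⟨_, h, rfl⟩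
    · intro v hv w hw hvw
      subst hvw
      obtain ⟨q, hq, rfl⟩ := hmem_map _ hv
      have := g7 f q hw
      rw [upd_apply, if_pos rfl] at this
      exact this (List.mem_append_right _ hq)
  · -- faces in `Δ`
    intro f' q hq
    rcases List.mem_cons.1 hq with h | h
    · cases h
    rcases List.mem_append.1 h with h | h
    · obtain ⟨q', -, hq'⟩ := hmem_map _ h
      cases hq'
      exact hfΔ
    · exact g5 f' q h
  · -- ports
    rw [List.filterMap_cons_some (f := Sum.getLeft?) (a := Sum.inl e₀) (b := e₀) rfl,
      List.filterMap_append, g6, List.filterMap_eq_nil_iff.2 fun v hv => ?_, List.nil_append]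
    obtain ⟨q, -, rfl⟩ := hmem_map _ hv
    rfl
  · -- used vertices
    intro f' q hq
    rcases List.mem_cons.1 hq with h | h
    · cases h
    rcases List.mem_append.1 h with h | h
    · obtain ⟨q', hq', hqq'⟩ := hmem_map _ h
      cases hqq'
      exact hrU _ hq'
    · have := g7 f' q h
      rw [upd_apply] at this
      split_ifs at this with hff
      · subst hff
        exact fun hU => this (List.mem_append_left _ hU)
      · exact this

end Compass

end Summit.CriticalPhenomena.SAWScalingLimit.Cruxes.HexTransfer.Sketch.PortDict
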